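import Literature.Probability.LatticeModels.MarkedClusterFamilies
import HarnessLib

/-!
# Rooted connected partitions: a connected vertex set with `k` marked vertices splits into `k` connected parts, one mark each —
# and Gottesman's `𝓜(S)` generating-function bound WITHOUT the square-root loss

Index of sources: `[cite: Gottesman2014]` = D. Gottesman, QIC 14 (2014), arXiv:1310.2984, §4 Lemma 2 (`#{W ∈ 𝓜(S) : |W| = t} ≤ (ed)^t/(e d^{|S|})`, proved by
charging every `W ∈ 𝓜(S)` to a family of connected sets rooted at the points of `S`); `[cite: FawziGrospellierLeverrier2018FT]` Def. 23 and the proof of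
Thm. 13 (arXiv:1808.03821 p0020 L7-16, p0022); `[cite: FriedliVelenik2017]` eq. (5.27) (tree `card_le_pow_of_isGraphConnected`).

Topic `Literature/Probability/LatticeModels` (generic graph combinatorics; consumer: venture QEC line L-SSF-NOISY). Two results:

* `exists_rooted_connected_partition` — for a `G`-connected finite set `C` and a nonempty set of marks `M ⊆ C` there are pairwise disjoint
  `G`-connected sets `P m ∋ m` (`m ∈ M`) inside `C` covering `C` (induction on `|C|`: a maximal connected part through one mark avoiding the others;
  the components of the rest each meet a remaining mark, by maximality);
* ★ `sum_pow_card_marked_le_rooted` — `Σ_{W ∈ 𝓜(S)} y^{|W|} ≤ (Σ_{k=1}^{|V|} Δ^{2(k−1)} y^k)^{|S|}` for `0 ≤ y` and `S ≠ ∅` (charge `W` to the rooted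
  partition of each of its components by its marks; the encoding `s ↦ part of s` is injective with `|W| = Σ_s |part|`; Peierls count per root) — the
  form of Gottesman's Lemma 2 that keeps the full exponent (no `√`), with the Peierls constant `Δ^{2(k−1)}` in place of `(ed)^{k}`.

PROVED (kernel); no definitions, no named facts. Statements ours in form (Peierls constants); the mechanism is Gottesman's.
-/

namespace Literature.Probability.LatticeModels

open Finset SimpleGraph

variable {V : Type*} [Fintype V] [DecidableEq V] {G : SimpleGraph V} [DecidableRel G.Adj]

omit [Fintype V] [DecidableRel G.Adj] in
/-- Gluing: two connected sets joined by an edge form a connected set. [folklore] -/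
private theorem isGraphConnected_union_of_adj {A K : Finset V} (hA : IsGraphConnected G A) (hK : IsGraphConnected G K)
    {a b : V} (ha : a ∈ A) (hb : b ∈ K) (hab : G.Adj a b) : IsGraphConnected G (A ∪ K) := by
  classical
  intro X hX hXne hcne
  -- case analysis on how `X` meets `A` and `K`
  by_cases hXA : (X ∩ A).Nonempty ∧ (A \ X).Nonempty
  · obtain ⟨x, hx, z, hz, hxz⟩ := hA (X ∩ A) Finset.inter_subset_right hXA.1
      (by obtain ⟨w, hw⟩ := hXA.2; exact ⟨w, by rw [Finset.mem_sdiff] at hw ⊢; exact ⟨hw.1, fun h => hw.2 (Finset.mem_inter.1 h).1⟩⟩)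
    refine ⟨x, (Finset.mem_inter.1 hx).1, z, ?_, hxz⟩
    rw [Finset.mem_sdiff] at hz ⊢
    exact ⟨Finset.mem_union_left _ hz.1, fun h => hz.2 (Finset.mem_inter.2 ⟨h, hz.1⟩)⟩
  by_cases hXK : (X ∩ K).Nonempty ∧ (K \ X).Nonempty
  · obtain ⟨x, hx, z, hz, hxz⟩ := hK (X ∩ K) Finset.inter_subset_right hXK.1
      (by obtain ⟨w, hw⟩ := hXK.2; exact ⟨w, by rw [Finset.mem_sdiff] at hw ⊢; exact ⟨hw.1, fun h => hw.2 (Finset.mem_inter.1 h).1⟩⟩)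
    refine ⟨x, (Finset.mem_inter.1 hx).1, z, ?_, hxz⟩
    rw [Finset.mem_sdiff] at hz ⊢
    exact ⟨Finset.mem_union_right _ hz.1, fun h => hz.2 (Finset.mem_inter.2 ⟨h, hz.1⟩)⟩
  -- now `X` contains all of `A` or misses `A`, and likewise for `K`
  rw [not_and_or, Finset.not_nonempty_iff_eq_empty, Finset.not_nonempty_iff_eq_empty] at hXA hXK
  have hAcase : A ⊆ X ∨ Disjoint X A := by
    rcases hXA with h | h
    · right; rw [Finset.disjoint_iff_inter_eq_empty]; exact h
    · left; intro v hv; by_contra hvX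
      have : v ∈ A \ X := Finset.mem_sdiff.2 ⟨hv, hvX⟩
      rw [h] at this; exact Finset.notMem_empty _ this
  have hKcase : K ⊆ X ∨ Disjoint X K := by
    rcases hXK with h | h
    · right; rw [Finset.disjoint_iff_inter_eq_empty]; exact h
    · left; intro v hv; by_contra hvX
      have : v ∈ K \ X := Finset.mem_sdiff.2 ⟨hv, hvX⟩
      rw [h] at this; exact Finset.notMem_empty _ this
  rcases hAcase with hAX | hAX <;> rcases hKcase with hKX | hKX
  · -- `X ⊇ A ∪ K`: complement empty
    exfalso
    obtain ⟨w, hw⟩ := hcne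
    rw [Finset.mem_sdiff, Finset.mem_union] at hw
    rcases hw.1 with h | h
    · exact hw.2 (hAX h)
    · exact hw.2 (hKX h)
  · -- `A ⊆ X`, `X ∩ K = ∅`: the edge `a b` crosses
    refine ⟨a, hAX ha, b, ?_, hab⟩
    rw [Finset.mem_sdiff]
    exact ⟨Finset.mem_union_right _ hb, fun h => Finset.disjoint_left.1 hKX h hb⟩
  · refine ⟨b, hKX hb, a, ?_, hab.symm⟩
    rw [Finset.mem_sdiff]
    exact ⟨Finset.mem_union_left _ ha, fun h => Finset.disjoint_left.1 hAX h ha⟩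
  · -- `X` misses both: `X` empty
    exfalso
    obtain ⟨x, hx⟩ := hXne
    rcases Finset.mem_union.1 (hX hx) with h | h
    · exact Finset.disjoint_left.1 hAX hx h
    · exact Finset.disjoint_left.1 hKX hx h

omit [Fintype V] [DecidableRel G.Adj] in
/-- **Rooted connected partition.** A `G`-connected finite set `C` with a nonempty set of marked vertices `M ⊆ C` is the disjoint union of `|M|`
`G`-connected sets `P m` with `m ∈ P m ⊆ C` (`m ∈ M`). (The combinatorial heart of Gottesman's Lemma 2.) [cite: Gottesman2014, Lemma 2 (mechanism)] -/
theorem exists_rooted_connected_partition (C : Finset V) (hC : IsGraphConnected G C) (M : Finset V) (hM : M ⊆ C) (hMne : M.Nonempty) :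
    ∃ P : V → Finset V, (∀ m ∈ M, m ∈ P m ∧ P m ⊆ C ∧ IsGraphConnected G (P m)) ∧
      (∀ m ∈ M, ∀ m' ∈ M, m ≠ m' → Disjoint (P m) (P m')) ∧ C = M.biUnion P := by
  classical
  -- strong induction on `|C|`
  suffices h : ∀ n : ℕ, ∀ C : Finset V, C.card ≤ n → IsGraphConnected G C → ∀ M : Finset V, M ⊆ C → M.Nonempty →
      ∃ P : V → Finset V, (∀ m ∈ M, m ∈ P m ∧ P m ⊆ C ∧ IsGraphConnected G (P m)) ∧
        (∀ m ∈ M, ∀ m' ∈ M, m ≠ m' → Disjoint (P m) (P m')) ∧ C = M.biUnion P from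
    h _ C le_rfl hC M hM hMne
  intro n
  induction n with
  | zero =>
    intro C hC _ M hM hMne
    obtain ⟨m, hm⟩ := hMne
    have : C.card = 0 := Nat.le_zero.1 hC
    rw [Finset.card_eq_zero] at this
    rw [this] at hM
    exact absurd (hM hm) (Finset.notMem_empty m)
  | succ n ih =>
    intro C hCn hC M hM hMne
    obtain ⟨m₀, hm₀⟩ := hMne
    -- a maximal connected `A ∋ m₀` inside `C` avoiding the other marks
    set cands : Finset (Finset V) := C.powerset.filter fun A =>
        m₀ ∈ A ∧ IsGraphConnected G A ∧ ∀ m ∈ M, m ∈ A → m = m₀ with hcands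
    have hcne : cands.Nonempty := by
      refine ⟨{m₀}, ?_⟩
      rw [hcands, Finset.mem_filter, Finset.mem_powerset]
      refine ⟨Finset.singleton_subset_iff.2 (hM hm₀), Finset.mem_singleton_self _, isGraphConnected_singleton m₀, ?_⟩
      intro m _ hm; exact Finset.mem_singleton.1 hm
    obtain ⟨A, hAc, hAmax⟩ := Finset.exists_max_image cands Finset.card hcne
    rw [hcands, Finset.mem_filter, Finset.mem_powerset] at hAc
    obtain ⟨hAC, hm₀A, hAconn, hAmarks⟩ := hAc
    -- the rest `R = C \ A` and its components
    set R : Finset V := C \ A with hR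
    let joined : V → V → Prop := fun a b => Relation.ReflTransGen (fun x z => G.Adj x z ∧ x ∈ R ∧ z ∈ R) a b
    let comp : V → Finset V := fun q => R.filter fun q' => joined q q'
    have mem_comp : ∀ {q q' : V}, q' ∈ comp q ↔ q' ∈ R ∧ joined q q' := by
      intro q q'; simp only [comp, Finset.mem_filter]
    have comp_subset : ∀ q, comp q ⊆ R := fun q q' hq' => (mem_comp.1 hq').1
    have self_mem : ∀ {q}, q ∈ R → q ∈ comp q := fun hq => mem_comp.2 ⟨hq, Relation.ReflTransGen.refl⟩
    have jsymm : ∀ {a b : V}, joined a b → joined b a := by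
      intro a b hab
      haveI : Std.Symm (fun x z => G.Adj x z ∧ x ∈ R ∧ z ∈ R) := ⟨fun x z hxz => ⟨hxz.1.symm, hxz.2.2, hxz.2.1⟩⟩
      exact Std.Symm.symm _ _ hab
    have comp_eq : ∀ {q q' : V}, q' ∈ comp q → comp q' = comp q := by
      intro q q' h
      rw [mem_comp] at h
      ext z
      rw [mem_comp, mem_comp]
      constructor
      · rintro ⟨hz, hqz⟩; exact ⟨hz, h.2.trans hqz⟩
      · rintro ⟨hz, hqz⟩; exact ⟨hz, (jsymm h.2).trans hqz⟩
    have closed : ∀ {q a b : V}, a ∈ comp q → b ∈ R → G.Adj a b → b ∈ comp q := by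
      intro q a b ha hb hab
      rw [mem_comp] at ha ⊢
      exact ⟨hb, ha.2.tail ⟨hab, ha.1, hb⟩⟩
    have conn : ∀ {q}, q ∈ R → IsGraphConnected G (comp q) := by
      intro q hq
      rw [isGraphConnected_iff_reflTransGen (hv := self_mem hq)]
      intro z hz
      rw [mem_comp] at hz
      have key : ∀ z, joined q z →
          Relation.ReflTransGen (fun a b => G.Adj a b ∧ a ∈ comp q ∧ b ∈ comp q) q z := by
        intro z hz
        induction hz with
        | refl => exact Relation.ReflTransGen.refl
        | @tail u v hu huv ih' =>
          have hu' : u ∈ comp q := mem_comp.2 ⟨huv.2.1, hu⟩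
          exact ih'.tail ⟨huv.1, hu', closed hu' huv.2.2 huv.1⟩
      exact key z hz.2
    -- every component of `R` meets `M` (maximality of `A`)
    have hmeet : ∀ q ∈ R, (comp q ∩ M).Nonempty := by
      intro q hq
      by_contra hnone
      rw [Finset.not_nonempty_iff_eq_empty] at hnone
      -- an edge from the component `K = comp q` to `C \ K`
      set K := comp q with hK
      have hKC : K ⊆ C := fun v hv => (Finset.mem_sdiff.1 (comp_subset q hv)).1
      have hKne : K.Nonempty := ⟨q, self_mem hq⟩
      have hCK : (C \ K).Nonempty := ⟨m₀, Finset.mem_sdiff.2 ⟨hM hm₀, fun h =>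
        (Finset.mem_sdiff.1 (comp_subset q h)).2 hm₀A⟩⟩
      obtain ⟨a, haK, b, hbCK, hab⟩ := hC K hKC hKne hCK
      rw [Finset.mem_sdiff] at hbCK
      -- `b ∈ A` (else `b ∈ R` adjacent to `K`, so `b ∈ K`)
      have hbA : b ∈ A := by
        by_contra hbA
        have hbR : b ∈ R := Finset.mem_sdiff.2 ⟨hbCK.1, hbA⟩
        exact hbCK.2 (closed haK hbR hab)
      -- then `A ∪ K` is a bigger candidate
      have hAK : A ∪ K ∈ cands := by
        rw [hcands, Finset.mem_filter, Finset.mem_powerset]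
        refine ⟨Finset.union_subset hAC hKC, Finset.mem_union_left _ hm₀A,
          isGraphConnected_union_of_adj hAconn (conn hq) hbA haK hab.symm, ?_⟩
        intro m hm hmAK
        rcases Finset.mem_union.1 hmAK with h | h
        · exact hAmarks m hm h
        · exfalso
          have : m ∈ K ∩ M := Finset.mem_inter.2 ⟨h, hm⟩
          rw [hnone] at this
          exact Finset.notMem_empty _ this
      have hcard := hAmax (A ∪ K) hAK
      have hlt : A.card < (A ∪ K).card := by
        refine Finset.card_lt_card ⟨Finset.subset_union_left, fun h => ?_⟩
        have hqA : q ∈ A := h (Finset.mem_union_right _ (self_mem hq))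
        exact (Finset.mem_sdiff.1 hq).2 hqA
      omega
    -- induction hypothesis on each component
    have hIH : ∀ q ∈ R, ∃ P : V → Finset V, (∀ m ∈ comp q ∩ M, m ∈ P m ∧ P m ⊆ comp q ∧ IsGraphConnected G (P m)) ∧
        (∀ m ∈ comp q ∩ M, ∀ m' ∈ comp q ∩ M, m ≠ m' → Disjoint (P m) (P m')) ∧ comp q = (comp q ∩ M).biUnion P := by
      intro q hq
      have hlt : (comp q).card ≤ n := by
        have h1 : (comp q).card < C.card := by
          refine Finset.card_lt_card ⟨fun v hv => (Finset.mem_sdiff.1 (comp_subset q hv)).1, fun h => ?_⟩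
          exact (Finset.mem_sdiff.1 (comp_subset q (h (hM hm₀)))).2 hm₀A
        omega
      exact ih (comp q) hlt (conn hq) (comp q ∩ M) Finset.inter_subset_left (hmeet q hq)
    choose! Pc hPc using hIH
    -- canonical representative of a component (depends only on the component as a set)
    let rep : Finset V → V := fun T => if h : T.Nonempty then h.choose else m₀
    have rep_mem : ∀ {T : Finset V}, T.Nonempty → rep T ∈ T := by
      intro T h; simp only [rep, dif_pos h]; exact h.choose_spec
    let ρ : V → V := fun m => rep (comp m)
    have hρ : ∀ {m}, m ∈ R → ρ m ∈ comp m := fun hm => rep_mem ⟨_, self_mem hm⟩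
    have hρR : ∀ {m}, m ∈ R → ρ m ∈ R := fun hm => comp_subset _ (hρ hm)
    have hρcomp : ∀ {m}, m ∈ R → comp (ρ m) = comp m := fun hm => comp_eq (hρ hm)
    have hρeq : ∀ {m m'}, m ∈ R → m' ∈ comp m → ρ m' = ρ m := by
      intro m m' hm hm'
      show rep (comp m') = rep (comp m)
      rw [comp_eq hm']
    -- marks other than `m₀` lie in `R`, and `m₀ ∉ R`
    have hmR : ∀ m ∈ M, m ≠ m₀ → m ∈ R := by
      intro m hm hne
      exact Finset.mem_sdiff.2 ⟨hM hm, fun h => hne (hAmarks m hm h)⟩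
    have hm₀R : m₀ ∉ R := fun h => (Finset.mem_sdiff.1 h).2 hm₀A
    -- the part of a mark `m ≠ m₀`: from the family of ITS COMPONENT (rooted at `ρ m`)
    have hPm : ∀ m ∈ M, m ≠ m₀ →
        m ∈ Pc (ρ m) m ∧ Pc (ρ m) m ⊆ comp m ∧ IsGraphConnected G (Pc (ρ m) m) := by
      intro m hm hne
      have hmRm := hmR m hm hne
      have h := (hPc (ρ m) (hρR hmRm)).1 m (by rw [hρcomp hmRm]; exact Finset.mem_inter.2 ⟨self_mem hmRm, hm⟩)
      rw [hρcomp hmRm] at h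
      exact h
    refine ⟨fun m => if m = m₀ then A else Pc (ρ m) m, ?_, ?_, ?_⟩
    · intro m hm
      by_cases hme : m = m₀
      · subst hme; simp only [if_true]; exact ⟨hm₀A, hAC, hAconn⟩
      · simp only [hme, if_false]
        obtain ⟨h1, h2, h3⟩ := hPm m hm hme
        exact ⟨h1, h2.trans fun v hv => (Finset.mem_sdiff.1 (comp_subset m hv)).1, h3⟩
    · intro m hm m' hm' hne
      by_cases hme : m = m₀
      · subst hme
        have hne' : m' ≠ m := fun h => hne h.symm
        simp only [if_true, hne', if_false]
        rw [Finset.disjoint_left]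
        intro v hvA hv'
        have hvR := comp_subset m' ((hPm m' hm' hne').2.1 hv')
        exact (Finset.mem_sdiff.1 hvR).2 hvA
      · by_cases hme' : m' = m₀
        · subst hme'
          simp only [hme, if_false, if_true]
          rw [Finset.disjoint_left]
          intro v hv hvA
          have hvR := comp_subset m ((hPm m hm hme).2.1 hv)
          exact (Finset.mem_sdiff.1 hvR).2 hvA
        · simp only [hme, hme', if_false]
          have hmRm := hmR m hm hme
          have hmRm' := hmR m' hm' hme'
          by_cases hsame : m' ∈ comp m
          · -- same component: same family (same root), IH disjointness
            have hρ' : ρ m' = ρ m := hρeq hmRm hsame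
            rw [hρ']
            have hfam := (hPc (ρ m) (hρR hmRm)).2.1
            rw [hρcomp hmRm] at hfam
            exact hfam m (Finset.mem_inter.2 ⟨self_mem hmRm, hm⟩) m' (Finset.mem_inter.2 ⟨hsame, hm'⟩) hne
          · -- different components: disjoint supports
            rw [Finset.disjoint_left]
            intro v hv hv'
            have h1 := (hPm m hm hme).2.1 hv
            have h2 := (hPm m' hm' hme').2.1 hv'
            exact hsame (by rw [← comp_eq h1, comp_eq h2]; exact self_mem hmRm')
    · -- cover
      ext v
      rw [Finset.mem_biUnion]
      constructor
      · intro hv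
        by_cases hvA : v ∈ A
        · exact ⟨m₀, hm₀, by simp [hvA]⟩
        · have hvR : v ∈ R := Finset.mem_sdiff.2 ⟨hv, hvA⟩
          -- the family of `comp v` covers it
          have hcov := (hPc (ρ v) (hρR hvR)).2.2
          rw [hρcomp hvR] at hcov
          have hv' : v ∈ (comp v ∩ M).biUnion (Pc (ρ v)) := by rw [← hcov]; exact self_mem hvR
          obtain ⟨m, hm, hvm⟩ := Finset.mem_biUnion.1 hv'
          have hmC : m ∈ comp v := (Finset.mem_inter.1 hm).1
          have hmM : m ∈ M := (Finset.mem_inter.1 hm).2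
          have hmne : m ≠ m₀ := fun h => hm₀R (h ▸ comp_subset v hmC)
          refine ⟨m, hmM, ?_⟩
          simp only [hmne, if_false]
          rw [hρeq hvR hmC]
          exact hvm
      · rintro ⟨m, hm, hvm⟩
        by_cases hme : m = m₀
        · subst hme; simp only [if_true] at hvm; exact hAC hvm
        · simp only [hme, if_false] at hvm
          exact (Finset.mem_sdiff.1 (comp_subset m ((hPm m hm hme).2.1 hvm))).1

/-- ★ **Gottesman's `𝓜(S)` bound without the square-root loss**: for degrees `≤ Δ`, marks `S`, and `0 ≤ y`,
`Σ_{W ∈ 𝓜(S)} y^{|W|} ≤ (Σ_{k=1}^{|V|} Δ^{2(k−1)} y^k)^{|S|}` (`𝓜(S)` as in `sum_pow_card_marked_le`). Proof: charge `W` to the rooted connected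
partition of each of its components by its marks (`exists_rooted_connected_partition`); the encoding `s ↦ part of s` is injective with
`|W| = Σ_{s ∈ S} |part of s|`, and each part is a connected set through `s` (Peierls count `Δ^{2(k−1)}` per size `k`).
[cite: Gottesman2014, Lemma 2 (with the Peierls constant)] [cite: FawziGrospellierLeverrier2018FT, Def 23 and proof of Thm 13 (arXiv p0020 L7-16, p0022)] -/
theorem sum_pow_card_marked_le_rooted {Δ : ℕ} (hΔ : ∀ x, G.degree x ≤ Δ) (S : Finset V)
    [DecidablePred fun W : Finset V => S ⊆ W ∧ ∀ q ∈ W, ∃ s ∈ S,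
      Relation.ReflTransGen (fun a b => G.Adj a b ∧ a ∈ W ∧ b ∈ W) q s]
    {y : ℝ} (hy0 : 0 ≤ y) :
    ∑ W ∈ univ.filter (fun W : Finset V => S ⊆ W ∧ ∀ q ∈ W, ∃ s ∈ S,
        Relation.ReflTransGen (fun a b => G.Adj a b ∧ a ∈ W ∧ b ∈ W) q s), y ^ W.card
      ≤ (∑ k ∈ Finset.Icc 1 (Fintype.card V), (Δ : ℝ) ^ (2 * (k - 1)) * y ^ k) ^ S.card := by
  classical
  set F : ℝ := ∑ k ∈ Finset.Icc 1 (Fintype.card V), (Δ : ℝ) ^ (2 * (k - 1)) * y ^ k with hFdef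
  have hF0 : 0 ≤ F := Finset.sum_nonneg fun k _ => by positivity
  set M : Finset (Finset V) := univ.filter (fun W : Finset V => S ⊆ W ∧ ∀ q ∈ W, ∃ s ∈ S,
      Relation.ReflTransGen (fun a b => G.Adj a b ∧ a ∈ W ∧ b ∈ W) q s) with hMdef
  -- components of a set `W`
  let joined : Finset V → V → V → Prop := fun W a b =>
    Relation.ReflTransGen (fun x z => G.Adj x z ∧ x ∈ W ∧ z ∈ W) a b
  let comp : Finset V → V → Finset V := fun W q => W.filter fun q' => joined W q q'
  have mem_comp : ∀ {W : Finset V} {q q' : V}, q' ∈ comp W q ↔ q' ∈ W ∧ joined W q q' := by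
    intro W q q'; simp only [comp, Finset.mem_filter]
  have comp_subset : ∀ (W : Finset V) (q : V), comp W q ⊆ W := fun W q q' hq' => (mem_comp.1 hq').1
  have self_mem : ∀ {W : Finset V} {q : V}, q ∈ W → q ∈ comp W q :=
    fun hq => mem_comp.2 ⟨hq, Relation.ReflTransGen.refl⟩
  have jsymm : ∀ {W : Finset V} {a b : V}, joined W a b → joined W b a := by
    intro W a b hab
    haveI : Std.Symm (fun x z => G.Adj x z ∧ x ∈ W ∧ z ∈ W) := ⟨fun x z hxz => ⟨hxz.1.symm, hxz.2.2, hxz.2.1⟩⟩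
    exact Std.Symm.symm _ _ hab
  have comp_eq : ∀ {W : Finset V} {q q' : V}, q' ∈ comp W q → comp W q' = comp W q := by
    intro W q q' h
    rw [mem_comp] at h
    ext z
    rw [mem_comp, mem_comp]
    constructor
    · rintro ⟨hz, hqz⟩; exact ⟨hz, h.2.trans hqz⟩
    · rintro ⟨hz, hqz⟩; exact ⟨hz, (jsymm h.2).trans hqz⟩
  have closed : ∀ {W : Finset V} {q a b : V}, a ∈ comp W q → b ∈ W → G.Adj a b → b ∈ comp W q := by
    intro W q a b ha hb hab
    rw [mem_comp] at ha ⊢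
    exact ⟨hb, ha.2.tail ⟨hab, ha.1, hb⟩⟩
  have conn : ∀ {W : Finset V} {q : V}, q ∈ W → IsGraphConnected G (comp W q) := by
    intro W q hq
    rw [isGraphConnected_iff_reflTransGen (hv := self_mem hq)]
    intro z hz
    rw [mem_comp] at hz
    have key : ∀ z, joined W q z →
        Relation.ReflTransGen (fun a b => G.Adj a b ∧ a ∈ comp W q ∧ b ∈ comp W q) q z := by
      intro z hz
      induction hz with
      | refl => exact Relation.ReflTransGen.refl
      | @tail u v hu huv ih =>
        have hu' : u ∈ comp W q := mem_comp.2 ⟨huv.2.1, hu⟩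
        exact ih.tail ⟨huv.1, hu', closed hu' huv.2.2 huv.1⟩
    exact key z hz.2
  -- a global choice of rooted partitions
  let Part : Finset V → Finset V → V → Finset V := fun C N =>
    if h : IsGraphConnected G C ∧ N ⊆ C ∧ N.Nonempty then
      Classical.choose (exists_rooted_connected_partition (G := G) C h.1 N h.2.1 h.2.2) else fun _ => ∅
  have Part_spec : ∀ {C N : Finset V} (h : IsGraphConnected G C ∧ N ⊆ C ∧ N.Nonempty),
      (∀ m ∈ N, m ∈ Part C N m ∧ Part C N m ⊆ C ∧ IsGraphConnected G (Part C N m)) ∧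
      (∀ m ∈ N, ∀ m' ∈ N, m ≠ m' → Disjoint (Part C N m) (Part C N m')) ∧ C = N.biUnion (Part C N) := by
    intro C N h
    have := Classical.choose_spec (exists_rooted_connected_partition (G := G) C h.1 N h.2.1 h.2.2)
    simp only [Part, dif_pos h]
    exact this
  -- the encoding
  let g : Finset V → V → Finset V := fun W s =>
    if s ∈ S then Part (comp W s) (comp W s ∩ S) s else ∅
  have hgood : ∀ W ∈ M, ∀ s ∈ S, IsGraphConnected G (comp W s) ∧ comp W s ∩ S ⊆ comp W s ∧ (comp W s ∩ S).Nonempty := by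
    intro W hW s hs
    rw [hMdef, Finset.mem_filter] at hW
    exact ⟨conn (hW.2.1 hs), Finset.inter_subset_left, ⟨s, Finset.mem_inter.2 ⟨self_mem (hW.2.1 hs), hs⟩⟩⟩
  let A : V → Finset (Finset V) := fun s =>
    if s ∈ S then univ.filter fun T : Finset V => s ∈ T ∧ IsGraphConnected G T else {∅}
  -- (a) values in `A`
  have hgA : ∀ W ∈ M, g W ∈ Fintype.piFinset A := by
    intro W hW
    rw [Fintype.mem_piFinset]
    intro s
    by_cases hs : s ∈ S
    · have hsp := (Part_spec (hgood W hW s hs)).1 s (Finset.mem_inter.2 ⟨self_mem ?_, hs⟩)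
      · simp only [g, A, hs, if_true]
        rw [Finset.mem_filter]
        exact ⟨Finset.mem_univ _, hsp.1, hsp.2.2⟩
      · rw [hMdef, Finset.mem_filter] at hW; exact hW.2.1 hs
    · simp [g, A, hs]
  -- (b) cover
  have hcover : ∀ W ∈ M, W = S.biUnion (g W) := by
    intro W hW
    have hW' := hW
    rw [hMdef, Finset.mem_filter] at hW'
    ext q
    rw [Finset.mem_biUnion]
    constructor
    · intro hq
      obtain ⟨s, hs, hqs⟩ := hW'.2.2 q hq
      have hsT : s ∈ comp W q := mem_comp.2 ⟨hW'.2.1 hs, hqs⟩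
      have hTs : comp W s = comp W q := comp_eq hsT
      -- the family of the component `T = comp W s` covers it
      have hspec := Part_spec (hgood W hW s hs)
      have hqT : q ∈ comp W s := by rw [hTs]; exact self_mem hq
      have hq' : q ∈ (comp W s ∩ S).biUnion (Part (comp W s) (comp W s ∩ S)) := by
        rw [← hspec.2.2]; exact hqT
      obtain ⟨m, hm, hqm⟩ := Finset.mem_biUnion.1 hq'
      have hmT : m ∈ comp W s := (Finset.mem_inter.1 hm).1
      have hmS : m ∈ S := (Finset.mem_inter.1 hm).2
      have hcm : comp W m = comp W s := by rw [comp_eq hmT]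
      refine ⟨m, hmS, ?_⟩
      simp only [g, hmS, if_true, hcm]
      exact hqm
    · rintro ⟨s, hs, hq⟩
      simp only [g, hs, if_true] at hq
      have hspec := Part_spec (hgood W hW s hs)
      exact comp_subset W s ((hspec.1 s (Finset.mem_inter.2 ⟨self_mem (hW'.2.1 hs), hs⟩)).2.1 hq)
  -- (c) pairwise disjoint on `S`
  have hdisj : ∀ W ∈ M, (S : Set V).PairwiseDisjoint (g W) := by
    intro W hW s hs s' hs' hne
    have hs0 : s ∈ S := hs
    have hs0' : s' ∈ S := hs'
    have hW' := hW
    rw [hMdef, Finset.mem_filter] at hW'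
    rw [Function.onFun]
    simp only [g, hs0, hs0', if_true]
    by_cases hsame : s' ∈ comp W s
    · have hcs : comp W s' = comp W s := comp_eq hsame
      rw [hcs]
      have hspec := Part_spec (hgood W hW s hs0)
      exact hspec.2.1 s (Finset.mem_inter.2 ⟨self_mem (hW'.2.1 hs0), hs0⟩) s'
        (Finset.mem_inter.2 ⟨hsame, hs0'⟩) hne
    · rw [Finset.disjoint_left]
      intro v hv hv'
      have h1 := ((Part_spec (hgood W hW s hs0)).1 s (Finset.mem_inter.2 ⟨self_mem (hW'.2.1 hs0), hs0⟩)).2.1 hv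
      have h2 := ((Part_spec (hgood W hW s' hs0')).1 s' (Finset.mem_inter.2 ⟨self_mem (hW'.2.1 hs0'), hs0'⟩)).2.1 hv'
      exact hsame (by rw [← comp_eq h1, comp_eq h2]; exact self_mem (hW'.2.1 hs0'))
  have hcard : ∀ W ∈ M, W.card = ∑ s ∈ S, (g W s).card := by
    intro W hW
    conv_lhs => rw [hcover W hW]
    exact Finset.card_biUnion (hdisj W hW)
  have hpow : ∀ W ∈ M, y ^ W.card = ∏ s, y ^ (g W s).card := by
    intro W hW
    rw [Finset.prod_pow_eq_pow_sum, hcard W hW]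
    congr 1
    refine Finset.sum_subset (Finset.subset_univ S) ?_
    intro s _ hs
    simp [g, hs]
  have hinj : Set.InjOn g (M : Set (Finset V)) := by
    intro W hW W' hW' h
    rw [hcover W hW, hcover W' hW', h]
  have hstep : ∑ W ∈ M, y ^ W.card ≤ ∑ f ∈ Fintype.piFinset A, ∏ s, y ^ (f s).card := by
    rw [Finset.sum_congr rfl hpow,
      show (∑ x ∈ M, ∏ s, y ^ (g x s).card) = ∑ f ∈ M.image g, ∏ s, y ^ (f s).card from
        (Finset.sum_image (f := fun f : V → Finset V => ∏ s, y ^ (f s).card) hinj).symm]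
    refine Finset.sum_le_sum_of_subset_of_nonneg ?_ fun f _ _ => Finset.prod_nonneg fun s _ => pow_nonneg hy0 _
    intro f hf
    obtain ⟨W, hW, rfl⟩ := Finset.mem_image.1 hf
    exact hgA W hW
  have hfact : ∑ f ∈ Fintype.piFinset A, ∏ s, y ^ (f s).card = ∏ s, ∑ T ∈ A s, y ^ T.card :=
    (Finset.prod_univ_sum A fun s T => y ^ T.card).symm
  have hconnsum : ∀ s : V, ∑ T ∈ univ.filter (fun T : Finset V => s ∈ T ∧ IsGraphConnected G T), y ^ T.card ≤ F := by
    intro s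
    set Cs := univ.filter (fun T : Finset V => s ∈ T ∧ IsGraphConnected G T) with hCs
    have hmaps : ∀ T ∈ Cs, T.card ∈ Finset.Icc 1 (Fintype.card V) := by
      intro T hT
      rw [hCs, Finset.mem_filter] at hT
      rw [Finset.mem_Icc]
      exact ⟨Finset.card_pos.2 ⟨s, hT.2.1⟩, Finset.card_le_univ T⟩
    rw [← Finset.sum_fiberwise_of_maps_to hmaps]
    refine Finset.sum_le_sum fun k hk => ?_
    have hfib : ∑ T ∈ Cs.filter (fun T => T.card = k), y ^ T.card
        = ((Cs.filter fun T => T.card = k).card : ℝ) * y ^ k := by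
      rw [Finset.sum_congr rfl fun T hT => by rw [(Finset.mem_filter.1 hT).2], Finset.sum_const, nsmul_eq_mul]
    rw [hfib]
    refine mul_le_mul_of_nonneg_right ?_ (pow_nonneg hy0 _)
    have hcount := card_le_pow_of_isGraphConnected (G := G) hΔ (v := s) (n := k) (Cs.filter fun T => T.card = k)
      (fun T hT => by
        rw [Finset.mem_filter, hCs, Finset.mem_filter] at hT
        exact ⟨hT.1.2.1, hT.2, hT.1.2.2⟩)
    exact_mod_cast hcount
  have hfactor : ∀ s : V, ∑ T ∈ A s, y ^ T.card ≤ if s ∈ S then F else 1 := by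
    intro s
    by_cases hs : s ∈ S
    · simp only [A, hs, if_true]; exact hconnsum s
    · simp [A, hs]
  have hprod : ∏ s, ∑ T ∈ A s, y ^ T.card ≤ ∏ s : V, (if s ∈ S then F else (1 : ℝ)) :=
    Finset.prod_le_prod (fun s _ => Finset.sum_nonneg fun T _ => pow_nonneg hy0 _) fun s _ => hfactor s
  have hrhs : ∏ s : V, (if s ∈ S then F else (1 : ℝ)) = F ^ S.card := by
    rw [Finset.prod_ite, Finset.prod_const_one, mul_one, Finset.prod_const]
    congr 1
    rw [Finset.filter_mem_eq_inter, Finset.univ_inter]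
  calc ∑ W ∈ M, y ^ W.card ≤ ∑ f ∈ Fintype.piFinset A, ∏ s, y ^ (f s).card := hstep
    _ = ∏ s, ∑ T ∈ A s, y ^ T.card := hfact
    _ ≤ ∏ s : V, (if s ∈ S then F else (1 : ℝ)) := hprod
    _ = F ^ S.card := hrhs

end Literature.Probability.LatticeModels
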